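import Summits.BirchSwinnertonDyer.Rank1Residual.SecondDescent.BSDpFromSecondDescentNonemptyProp48
import Summits.BirchSwinnertonDyer.Rank1Residual.SecondDescent.BSDpFromSecondDescentNonemptyX4
import HarnessLib

/-!
# B-1 second-3-descent `NONEMPTY × 2` record SHAPES for a literal model, `Ш` currency, `hcard`-FREE (X8 / X7 / X6 with either upper half; X4 with Kato's) (cell `b2b-bsdres`, CLASS-CLOSURE instrument seat cc-eng-4, GEN 11)

HONEST FRAMING (run/shared/lean/b2b/bsd-rank1-residual/, verbatim in every file): the goal of the
cell is to DELETE the COMBINATION-SHAPED residual classes of the Birch–Swinnerton-Dyer formula for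
ALL analytic-rank `≤ 1` elliptic curves over `ℚ` — "full BSD formula for every rank `≤ 1` curve in
class `C`" assembled STRICTLY from published theorems — so that the rank-`≤ 1` remainder becomes
exactly the CONSTRUCTION-SHAPED classes, which are TYPED (missing-input `Prop`s), NOT attempted.
This is not "finishing BSD". Classes X4 / X6 / X7 / X8 stay as the map has them (X6 ANNOUNCED,
BSTW); these are per-pair record SHAPES (certificate consumers); the second-descent outputs that
instantiate them are INSTRUMENTATION (class-closure E4) / EVIDENCE under census-lead's tier label;
no lane verdict is changed; no named fact is added; nothing is booked by this unit. THEOREMS ONLY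
(no definition, no named fact, no `sorry`).

## What this file does

The literal-model `Ш`-currency record shapes of `NonemptyRecordsThree01.lean` (§2, Wuthrich upper
half), `BSDpFromSecondDescentNonemptyProp48.lean` (§2, Perrin-Riou Prop. 4.8 upper half) and
`NonemptyRecordsX4Three01.lean` (§1, Kato upper half) all carry the binder
`hcard : #Ш(E)[3] = 9`.  GEN 11 showed it is NOT needed: two `3`-torsion classes `c₁ ≠ 0`,
`c₂ ∉ ℤ∙c₁` of `Ш` that are both third multiples already force `3⁴ ∣ #Ш`
(`ShaDivisibleFromTwoNonempty.lean` appendix: `pow_four_dvd_card_sha_of_two_divisible'`; consumers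
`…'` in the three files above).  This file restates the SEVEN literal-model shapes with `hcard`
DELETED and nothing else changed.  What it buys a record filer: the EVIDENCE behind a B-1
`NONEMPTY × 2` record is the front's two independent `Sel₃` cubics + the two second-descent
witnesses + the analytic data — NO EXACT upper bound on `dim Sel₃(E/ℚ)` (the step bound to a
certified class group of the `3`-division octic field) is consumed; a GRH-grade front followed by
exact membership / independence / witness checks suffices.  Per pair; classes unchanged; nothing
booked.  References as in the three parent files: [Wuthrich2014] Prop. 21, [PerrinRiou2003]
Prop. 4.8, [Kato2004Asterisque] Thm. 14.5 (3), [Creutz2014] §1/§7, [SilvermanAEC2009] X.4.14,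
[Miller2011LMS] §1, [Serre1972].
-/

set_option autoImplicit false

noncomputable section

open scoped Classical

open WeierstrassCurve Literature.NumberTheory.EllipticCurves
  Literature.NumberTheory.EllipticCurves.ModularForms
  Literature.NumberTheory.EllipticCurves.Rank1Residual
  Literature.NumberTheory.EllipticCurves.Rank1Residual.Typed
  Literature.NumberTheory.EllipticCurves.Rank1Residual.X11RankOneCertificates
  Literature.NumberTheory.EllipticCurves.Wuthrich2014
  Literature.NumberTheory.EllipticCurves.PerrinRiou2003
  Summit.BirchSwinnertonDyer.Rank1Residual.Additive
  Summit.BirchSwinnertonDyer.Rank1Residual.X11b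

namespace Summit.BirchSwinnertonDyer.Rank1Residual.SecondDescent

/-! ### §1. Wuthrich upper half (`hW`), `hcard`-FREE -/

/-- **X8 ∩ {r_an = 0} ∩ {surj(3)}, literal model, `Ш` currency, `hcard`-FREE**: Wuthrich +
Cassels–Tate + GZK + modularity + [X8 at `3`, `ρ̄_{E,3}` onto, `r_an = 0`] + two `3`-torsion classes
`c₁ ≠ 0`, `c₂ ∉ ℤ∙c₁` of `Ш`, BOTH third multiples + `ord₃ #Ш_an ≤ 4` ⟹ `BSD(E,3)`
(= `X8.bsdp_three_rankZero_of_ainvs_of_casselsTate_of_two_nonempty_of_surj` without `#Ш[3] = 9`).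
Per pair; class X8 unchanged; nothing booked. [cite: Wuthrich2014, Prop. 21 (p. 400)]
[cite: SilvermanAEC2009, Thm. X.4.14] [cite: Creutz2014, §1] [cite: Miller2011LMS, §1 and Def. 1.1] -/
theorem X8.bsdp_three_rankZero_of_ainvs_of_casselsTate_of_two_nonempty_of_surj'
    (hCT : exists_casselsTate_pairing (K := ℚ)) (hW : sha_dvd_analyticSha)
    (hGZK : rank_eq_analyticRank_of_analyticRank_le_one) (hmod : hasEntireLFunction_rat)
    (a1 a2 a3 a4 a6 : ℤ) (hΔ : discOf [a1, a2, a3, a4, a6] ≠ 0)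
    (hmin : (⟨a1, a2, a3, a4, a6⟩ : WeierstrassCurve ℚ).IsGloballyMinimal)
    (hX : haveI := hmin; ClassX8 (⟨a1, a2, a3, a4, a6⟩ : WeierstrassCurve ℚ) 3)
    (hs : Surj (⟨a1, a2, a3, a4, a6⟩ : WeierstrassCurve ℚ) 3)
    (hr : (⟨a1, a2, a3, a4, a6⟩ : WeierstrassCurve ℚ).analyticRank = 0)
    {c₁ c₂ d₁ d₂ : (⟨a1, a2, a3, a4, a6⟩ : WeierstrassCurve ℚ).sha} (h1 : 3 • c₁ = 0)
    (h2 : 3 • c₂ = 0) (hc₁ : c₁ ≠ 0) (hind : c₂ ∉ AddSubgroup.zmultiples c₁) (hd₁ : 3 • d₁ = c₁)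
    (hd₂ : 3 • d₂ = c₂)
    {q : ℚ} (hq : shaAn (⟨a1, a2, a3, a4, a6⟩ : WeierstrassCurve ℚ) = (q : ℂ))
    (hv : padicValRat 3 q ≤ 4) : BSDp (⟨a1, a2, a3, a4, a6⟩ : WeierstrassCurve ℚ) 3 := by
  haveI := isElliptic_of_discOf_ne_zero a1 a2 a3 a4 a6 hΔ
  haveI := hmin
  exact X8.bsdp_three_rankZero_of_casselsTate_of_two_nonempty_of_surj' hCT hW hGZK hmod _ hX hs hr
    h1 h2 hc₁ hind hd₁ hd₂ hq hv

/-- **X7 ∩ {r_an = 0}, surj(3), literal model, `Ш` currency, `hcard`-FREE**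
(= `X7.bsdp_three_rankZero_of_ainvs_of_casselsTate_of_two_nonempty_of_surj` without `#Ш[3] = 9`).
Per pair; class X7 unchanged; nothing booked. [cite: Wuthrich2014, Prop. 21 (p. 400)]
[cite: SilvermanAEC2009, Thm. X.4.14] [cite: Creutz2014, §1] [cite: Miller2011LMS, §1 and Def. 1.1] -/
theorem X7.bsdp_three_rankZero_of_ainvs_of_casselsTate_of_two_nonempty_of_surj'
    (hCT : exists_casselsTate_pairing (K := ℚ)) (hW : sha_dvd_analyticSha)
    (hGZK : rank_eq_analyticRank_of_analyticRank_le_one) (hmod : hasEntireLFunction_rat)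
    (a1 a2 a3 a4 a6 : ℤ) (hΔ : discOf [a1, a2, a3, a4, a6] ≠ 0)
    (hmin : (⟨a1, a2, a3, a4, a6⟩ : WeierstrassCurve ℚ).IsGloballyMinimal)
    (hX : haveI := hmin; ClassX7 (⟨a1, a2, a3, a4, a6⟩ : WeierstrassCurve ℚ) 3)
    (hs : Surj (⟨a1, a2, a3, a4, a6⟩ : WeierstrassCurve ℚ) 3)
    (hr : (⟨a1, a2, a3, a4, a6⟩ : WeierstrassCurve ℚ).analyticRank = 0)
    {c₁ c₂ d₁ d₂ : (⟨a1, a2, a3, a4, a6⟩ : WeierstrassCurve ℚ).sha} (h1 : 3 • c₁ = 0)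
    (h2 : 3 • c₂ = 0) (hc₁ : c₁ ≠ 0) (hind : c₂ ∉ AddSubgroup.zmultiples c₁) (hd₁ : 3 • d₁ = c₁)
    (hd₂ : 3 • d₂ = c₂)
    {q : ℚ} (hq : shaAn (⟨a1, a2, a3, a4, a6⟩ : WeierstrassCurve ℚ) = (q : ℂ))
    (hv : padicValRat 3 q ≤ 4) : BSDp (⟨a1, a2, a3, a4, a6⟩ : WeierstrassCurve ℚ) 3 := by
  haveI := isElliptic_of_discOf_ne_zero a1 a2 a3 a4 a6 hΔ
  haveI := hmin
  exact X7.bsdp_three_rankZero_of_casselsTate_of_two_nonempty_of_surj' hCT hW hGZK hmod _ hX hs hr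
    h1 h2 hc₁ hind hd₁ hd₂ hq hv

/-- **X6 ∩ {r_an = 0}, literal model, `Ш` currency, `hcard`-FREE** (image proviso automatic)
(= `X6.bsdp_three_rankZero_of_ainvs_of_casselsTate_of_two_nonempty` without `#Ш[3] = 9`). The N4@3
canary rows `271726d1 / 405130d1 / 152330l1` are its EVIDENCE pointers (records `bsdp3_b1n_·`,
p305257; `hcard`-free restatements in `NonemptyRecordsCardFree01.lean`). Per pair; class X6
unchanged; nothing booked. [cite: Wuthrich2014, Prop. 21 (p. 400)] [cite: SilvermanAEC2009, Thm. X.4.14]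
[cite: Creutz2014, §1] [cite: Miller2011LMS, §1 and Def. 1.1] -/
theorem X6.bsdp_three_rankZero_of_ainvs_of_casselsTate_of_two_nonempty'
    (hCT : exists_casselsTate_pairing (K := ℚ)) (hW : sha_dvd_analyticSha)
    (hGZK : rank_eq_analyticRank_of_analyticRank_le_one) (hmod : hasEntireLFunction_rat)
    (a1 a2 a3 a4 a6 : ℤ) (hΔ : discOf [a1, a2, a3, a4, a6] ≠ 0)
    (hmin : (⟨a1, a2, a3, a4, a6⟩ : WeierstrassCurve ℚ).IsGloballyMinimal)
    (hX : haveI := hmin; ClassX6 (⟨a1, a2, a3, a4, a6⟩ : WeierstrassCurve ℚ) 3)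
    (hr : (⟨a1, a2, a3, a4, a6⟩ : WeierstrassCurve ℚ).analyticRank = 0)
    {c₁ c₂ d₁ d₂ : (⟨a1, a2, a3, a4, a6⟩ : WeierstrassCurve ℚ).sha} (h1 : 3 • c₁ = 0)
    (h2 : 3 • c₂ = 0) (hc₁ : c₁ ≠ 0) (hind : c₂ ∉ AddSubgroup.zmultiples c₁) (hd₁ : 3 • d₁ = c₁)
    (hd₂ : 3 • d₂ = c₂)
    {q : ℚ} (hq : shaAn (⟨a1, a2, a3, a4, a6⟩ : WeierstrassCurve ℚ) = (q : ℂ))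
    (hv : padicValRat 3 q ≤ 4) : BSDp (⟨a1, a2, a3, a4, a6⟩ : WeierstrassCurve ℚ) 3 := by
  haveI := isElliptic_of_discOf_ne_zero a1 a2 a3 a4 a6 hΔ
  haveI := hmin
  exact X6.bsdp_three_rankZero_of_casselsTate_of_two_nonempty' hCT hW hGZK hmod _ hX hr h1 h2 hc₁
    hind hd₁ hd₂ hq hv

/-! ### §2. Perrin-Riou Prop. 4.8 upper half (`h48`), `hcard`-FREE -/

/-- **X8 ∩ {r_an = 0} ∩ {surj(3)}, literal model, `Ш` currency, upper half from Prop. 4.8,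
`hcard`-FREE** (= `X8.bsdp_three_rankZero_of_ainvs_of_casselsTate_of_two_nonempty_of_prop48_of_surj`
without `#Ш[3] = 9`). Per pair; class X8 unchanged; nothing booked.
[cite: PerrinRiou2003, Prop. 4.8 (p. 162)] [cite: Wuthrich2014, Lemma 20 (p. 399)]
[cite: SilvermanAEC2009, Thm. X.4.14] [cite: Creutz2014, §1] [cite: Miller2011LMS, §1 and Def. 1.1] -/
theorem X8.bsdp_three_rankZero_of_ainvs_of_casselsTate_of_two_nonempty_of_prop48_of_surj'
    (hCT : exists_casselsTate_pairing (K := ℚ)) (h48 : prop48_padicValRat_bsd_rank_zero_le)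
    (hGZK : rank_eq_analyticRank_of_analyticRank_le_one) (hmod : hasEntireLFunction_rat)
    (a1 a2 a3 a4 a6 : ℤ) (hΔ : discOf [a1, a2, a3, a4, a6] ≠ 0)
    (hmin : (⟨a1, a2, a3, a4, a6⟩ : WeierstrassCurve ℚ).IsGloballyMinimal)
    (hX : haveI := hmin; ClassX8 (⟨a1, a2, a3, a4, a6⟩ : WeierstrassCurve ℚ) 3)
    (hs : Surj (⟨a1, a2, a3, a4, a6⟩ : WeierstrassCurve ℚ) 3)
    (hr : (⟨a1, a2, a3, a4, a6⟩ : WeierstrassCurve ℚ).analyticRank = 0)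
    {c₁ c₂ d₁ d₂ : (⟨a1, a2, a3, a4, a6⟩ : WeierstrassCurve ℚ).sha} (h1 : 3 • c₁ = 0)
    (h2 : 3 • c₂ = 0) (hc₁ : c₁ ≠ 0) (hind : c₂ ∉ AddSubgroup.zmultiples c₁) (hd₁ : 3 • d₁ = c₁)
    (hd₂ : 3 • d₂ = c₂)
    {q : ℚ} (hq : shaAn (⟨a1, a2, a3, a4, a6⟩ : WeierstrassCurve ℚ) = (q : ℂ))
    (hv : padicValRat 3 q ≤ 4) : BSDp (⟨a1, a2, a3, a4, a6⟩ : WeierstrassCurve ℚ) 3 := by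
  haveI := isElliptic_of_discOf_ne_zero a1 a2 a3 a4 a6 hΔ
  haveI := hmin
  exact X8.bsdp_three_rankZero_of_casselsTate_of_two_nonempty_of_prop48_of_surj' hCT h48 hGZK hmod _
    hX hs hr h1 h2 hc₁ hind hd₁ hd₂ hq hv

/-- **X7 ∩ {r_an = 0}, surj(3), literal model, `Ш` currency, upper half from Prop. 4.8,
`hcard`-FREE** (= `X7.…_of_ainvs_…_of_prop48_of_surj` without `#Ш[3] = 9`). Per pair; class X7
unchanged; nothing booked. [cite: PerrinRiou2003, Prop. 4.8 (p. 162)] [cite: Wuthrich2014, Lemma 20 (p. 399)]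
[cite: SilvermanAEC2009, Thm. X.4.14] [cite: Creutz2014, §1] [cite: Miller2011LMS, §1 and Def. 1.1] -/
theorem X7.bsdp_three_rankZero_of_ainvs_of_casselsTate_of_two_nonempty_of_prop48_of_surj'
    (hCT : exists_casselsTate_pairing (K := ℚ)) (h48 : prop48_padicValRat_bsd_rank_zero_le)
    (hGZK : rank_eq_analyticRank_of_analyticRank_le_one) (hmod : hasEntireLFunction_rat)
    (a1 a2 a3 a4 a6 : ℤ) (hΔ : discOf [a1, a2, a3, a4, a6] ≠ 0)
    (hmin : (⟨a1, a2, a3, a4, a6⟩ : WeierstrassCurve ℚ).IsGloballyMinimal)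
    (hX : haveI := hmin; ClassX7 (⟨a1, a2, a3, a4, a6⟩ : WeierstrassCurve ℚ) 3)
    (hs : Surj (⟨a1, a2, a3, a4, a6⟩ : WeierstrassCurve ℚ) 3)
    (hr : (⟨a1, a2, a3, a4, a6⟩ : WeierstrassCurve ℚ).analyticRank = 0)
    {c₁ c₂ d₁ d₂ : (⟨a1, a2, a3, a4, a6⟩ : WeierstrassCurve ℚ).sha} (h1 : 3 • c₁ = 0)
    (h2 : 3 • c₂ = 0) (hc₁ : c₁ ≠ 0) (hind : c₂ ∉ AddSubgroup.zmultiples c₁) (hd₁ : 3 • d₁ = c₁)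
    (hd₂ : 3 • d₂ = c₂)
    {q : ℚ} (hq : shaAn (⟨a1, a2, a3, a4, a6⟩ : WeierstrassCurve ℚ) = (q : ℂ))
    (hv : padicValRat 3 q ≤ 4) : BSDp (⟨a1, a2, a3, a4, a6⟩ : WeierstrassCurve ℚ) 3 := by
  haveI := isElliptic_of_discOf_ne_zero a1 a2 a3 a4 a6 hΔ
  haveI := hmin
  exact X7.bsdp_three_rankZero_of_casselsTate_of_two_nonempty_of_prop48_of_surj' hCT h48 hGZK hmod _
    hX hs hr h1 h2 hc₁ hind hd₁ hd₂ hq hv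

/-- **X6 ∩ {r_an = 0}, literal model, `Ш` currency, upper half from Prop. 4.8, NO image binder,
`hcard`-FREE** (= `X6.…_of_ainvs_…_of_prop48` without `#Ш[3] = 9`). EVIDENCE pointers: the N4@3
canary rows. Per pair; class X6 unchanged; nothing booked. [cite: PerrinRiou2003, Prop. 4.8 (p. 162)]
[cite: Serre1972, §5.4 Prop. 21 i)] [cite: SilvermanAEC2009, Thm. X.4.14] [cite: Creutz2014, §1]
[cite: Miller2011LMS, §1 and Def. 1.1] -/
theorem X6.bsdp_three_rankZero_of_ainvs_of_casselsTate_of_two_nonempty_of_prop48'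
    (hCT : exists_casselsTate_pairing (K := ℚ)) (h48 : prop48_padicValRat_bsd_rank_zero_le)
    (hGZK : rank_eq_analyticRank_of_analyticRank_le_one) (hmod : hasEntireLFunction_rat)
    (a1 a2 a3 a4 a6 : ℤ) (hΔ : discOf [a1, a2, a3, a4, a6] ≠ 0)
    (hmin : (⟨a1, a2, a3, a4, a6⟩ : WeierstrassCurve ℚ).IsGloballyMinimal)
    (hX : haveI := hmin; ClassX6 (⟨a1, a2, a3, a4, a6⟩ : WeierstrassCurve ℚ) 3)
    (hr : (⟨a1, a2, a3, a4, a6⟩ : WeierstrassCurve ℚ).analyticRank = 0)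
    {c₁ c₂ d₁ d₂ : (⟨a1, a2, a3, a4, a6⟩ : WeierstrassCurve ℚ).sha} (h1 : 3 • c₁ = 0)
    (h2 : 3 • c₂ = 0) (hc₁ : c₁ ≠ 0) (hind : c₂ ∉ AddSubgroup.zmultiples c₁) (hd₁ : 3 • d₁ = c₁)
    (hd₂ : 3 • d₂ = c₂)
    {q : ℚ} (hq : shaAn (⟨a1, a2, a3, a4, a6⟩ : WeierstrassCurve ℚ) = (q : ℂ))
    (hv : padicValRat 3 q ≤ 4) : BSDp (⟨a1, a2, a3, a4, a6⟩ : WeierstrassCurve ℚ) 3 := by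
  haveI := isElliptic_of_discOf_ne_zero a1 a2 a3 a4 a6 hΔ
  haveI := hmin
  exact X6.bsdp_three_rankZero_of_casselsTate_of_two_nonempty_of_prop48' hCT h48 hGZK hmod _ hX hr
    h1 h2 hc₁ hind hd₁ hd₂ hq hv

/-! ### §3. X4 (additive at `3`, potentially good, `ρ̄_{E,9}` onto), Kato's upper half, `hcard`-FREE -/

/-- **X4 `NONEMPTY × 2` reading for a literal model, `p = 3`, analytic rank `0`, `ρ̄_{E,9}` onto,
`hcard`-FREE** (= `X4RankZero.bsdp_three_of_ainvs_of_kato_of_surj9_of_casselsTate_of_two_nonempty`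
without `#Ш[3] = 9`): Kato's upper half + GZK + modularity + Cassels–Tate + [X4 at `3`, `r_an = 0`,
`ord₃ j ≥ 0`, surj(9), `3 ∤ ∏ c_ℓ`, `3 ∤ c_D`] + two `3`-torsion classes `c₁ ≠ 0`, `c₂ ∉ ℤ∙c₁` of
`Ш` BOTH third multiples + `ord₃ #Ш_an ≤ 4` ⟹ `BSD(E,3)`. The shape of the window row `19215t1`.
Per pair; class X4 unchanged; nothing booked. [cite: Kato2004Asterisque, Thm. 14.5 (3) (p. 236)]
[cite: SilvermanAEC2009, Thm. X.4.14] [cite: Creutz2014, §1] [cite: Miller2011LMS, §1 and Def. 1.1] -/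
theorem X4RankZero.bsdp_three_of_ainvs_of_kato_of_surj9_of_casselsTate_of_two_nonempty'
    (hKato : Kato2004.rankZero_padicValNat_sha_le_of_additive_potGood_of_imageContainsSL2)
    (hGZK : rank_eq_analyticRank_of_analyticRank_le_one) (hmod : hasEntireLFunction_rat)
    (hCT : exists_casselsTate_pairing (K := ℚ))
    (a1 a2 a3 a4 a6 : ℤ) (hΔ : discOf [a1, a2, a3, a4, a6] ≠ 0)
    (hmin : (⟨a1, a2, a3, a4, a6⟩ : WeierstrassCurve ℚ).IsGloballyMinimal)
    (hr : (⟨a1, a2, a3, a4, a6⟩ : WeierstrassCurve ℚ).analyticRank = 0)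
    (hX : ClassX4 (⟨a1, a2, a3, a4, a6⟩ : WeierstrassCurve ℚ) 3)
    (hpot : haveI := isElliptic_of_discOf_ne_zero a1 a2 a3 a4 a6 hΔ
      0 ≤ padicValRat 3 (⟨a1, a2, a3, a4, a6⟩ : WeierstrassCurve ℚ).j)
    (h9 : (⟨a1, a2, a3, a4, a6⟩ : WeierstrassCurve ℚ).HasSurjectiveModNGaloisRep 9)
    (htam : ¬ 3 ∣ (⟨a1, a2, a3, a4, a6⟩ : WeierstrassCurve ℚ).tamagawaProduct)
    {N : ℕ} [NeZero N] (D : ModularParametrizationData (⟨a1, a2, a3, a4, a6⟩ : WeierstrassCurve ℚ) N)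
    (hc : ¬ (3 : ℤ) ∣ D.maninConstant)
    {c₁ c₂ d₁ d₂ : (⟨a1, a2, a3, a4, a6⟩ : WeierstrassCurve ℚ).sha} (h1 : 3 • c₁ = 0)
    (h2 : 3 • c₂ = 0) (hc₁ : c₁ ≠ 0) (hind : c₂ ∉ AddSubgroup.zmultiples c₁) (hd₁ : 3 • d₁ = c₁)
    (hd₂ : 3 • d₂ = c₂)
    {q : ℚ} (hq : shaAn (⟨a1, a2, a3, a4, a6⟩ : WeierstrassCurve ℚ) = (q : ℂ))
    (hv : padicValRat 3 q ≤ 4) : BSDp (⟨a1, a2, a3, a4, a6⟩ : WeierstrassCurve ℚ) 3 := by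
  haveI := isElliptic_of_discOf_ne_zero a1 a2 a3 a4 a6 hΔ
  haveI := hmin
  exact X4RankZero.bsdp_three_of_kato_of_surj9_of_casselsTate_of_two_nonempty' _ hKato hGZK hmod hCT
    hr hX hpot h9 htam D hc h1 h2 hc₁ hind hd₁ hd₂ hq hv

end Summit.BirchSwinnertonDyer.Rank1Residual.SecondDescent

end
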